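import Summits.AtomisticToContinuum.HydrodynamicLimit.Theorems.EquilibriumClampedCollisionalWindowLD.Negative.LatticeSep

/-!
# The Gibbs probability of the labelled events (helper file of the refutation of `EquilibriumClampedCollisionalWindowLD`, stmt-AtomisticToContinuum-13733; see `Cruxes/EquilibriumClampedCollisionalWindowLD/Disproof.lean` and the evidence WITNESS.md; no Theses declaration is asserted positively; refuter-cdisprove-stmt-AtomisticToContinuum-13733-0)
-/

noncomputable section

open Real
open scoped InnerProductSpace

namespace Summit.AtomisticToContinuum.HydrodynamicLimit.Theorems

namespace EquilibriumClampedCollisionalWindowLDNegative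

section Lattice

open Literature.Analysis.FluidPDE Literature.Analysis.FunctionSpaces
open Filter
open scoped Topology

namespace Lat

variable {Λ : Lat} {N : ℕ} {a : Fin (N + 1) ≃ Λ.Slot}

/-! ### The Gibbs probability of the labelled event -/

section Gibbs

open MeasureTheory Literature.MathematicalPhysics.KineticTheory

/-- The offset is measurable in the configuration. [folklore] -/
theorem measurable_offset (p : Fin (N + 1)) : Measurable fun z : Cfg N => Λ.offset a z p := by
  unfold offset
  exact Torus.measurable_reprSym.comp ((measurable_pi_apply p).fst.sub measurable_const)

/-- The labelled event is measurable. [folklore] -/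
theorem measurableSet_Ev : MeasurableSet (Λ.Ev a : Set (Cfg N)) := by
  have h : (Λ.Ev a : Set (Cfg N)) = ⋂ p, ({z | ‖Λ.offset a z p‖ ≤ Λ.P.r} ∩ {z | ‖(z p).2 - Λ.drv (a p)‖ ≤ Λ.P.u}) := by
    ext z; simp [Ev, Set.mem_iInter]
  rw [h]
  refine MeasurableSet.iInter fun p => MeasurableSet.inter ?_ ?_
  · exact measurableSet_le (measurable_offset p).norm measurable_const
  · exact measurableSet_le (((measurable_pi_apply p).snd.sub measurable_const).norm) measurable_const

/-- At time `0` no transfer happens. [folklore] -/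
theorem zero_not_mem_jumpTimes (hΛ : Λ.OK) {z : Cfg N} (hz : z ∈ Λ.Ev a) {b : ℕ} (hb : Λ.Active b)
    (ℓ : Fin Λ.n × Fin Λ.n) : (0 : ℝ) ∉ jumpTimes Λ.P (bv 0) (Λ.bdata a z b ℓ) := by
  intro h
  obtain ⟨j, hj1, hj2, hj0⟩ := mem_jumpTimes.1 h
  have := tHit_strictMonoOn hΛ.sep.adm (dataOK_of_mem hΛ hz hb ℓ) hj1 (by omega : j ≤ Λ.P.K)
  simp only [tHit_zero] at this
  linarith

/-- **The event lies in the hard-sphere domain.** [folklore] -/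
theorem Ev_subset_domain (hW : Λ.WinOK) {z : Cfg N} (hz : z ∈ Λ.Ev a) :
    z ∈ hardSphereDomain (Torus.geometry (Fin 3)) (N + 1) Λ.P.ε := by
  intro i j hij
  have h := cert_sep hW hz le_rfl hW.w_nn hij (fun hsb => zero_not_mem_jumpTimes hW.ok hz hsb.1 (a i).2)
  rw [cert_zero hW.ok hz] at h
  exact h.le

/-- **Distinct slots are far apart on the torus**: at least `min s (1/n)`. [folklore] -/
theorem slot_sep (hΛ : Λ.OK) {ς ς' : Λ.Slot} (hne : ς ≠ ς') :
    min Λ.P.s (1 / Λ.n) ≤ ‖(Torus.geometry (Fin 3)).sepVec (Torus.proj (Λ.slotVec ς)) (Torus.proj (Λ.slotVec ς'))‖ := by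
  have hn := hΛ.n_pos
  have hn0 : (0 : ℝ) < Λ.n := by exact_mod_cast hn
  by_cases hline : ς.2 = ς'.2
  · -- same line: coordinate 0, `(i - i') s` is at distance `≥ s` from every integer
    have hi : ς.1 ≠ ς'.1 := fun h => hne (Prod.ext h hline)
    have hi' : ς.1.1 ≠ ς'.1.1 := fun h => hi (Fin.ext h)
    refine (min_le_left _ _).trans (le_norm_sepVec_of_coord (i := 0) fun k => ?_)
    rw [slotVec_zero, slotVec_zero]
    have hsM : Λ.P.s * Λ.M = 1 := by
      rw [hΛ.s_eq]; have hM0 : (0:ℝ) < Λ.M := by exact_mod_cast hΛ.M_pos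
      field_simp
    have hs0 : 0 < Λ.P.s := hΛ.sep.adm.s_pos
    have prod : ∀ {u v : ℝ}, u ≤ v → u * Λ.P.s ≤ v * Λ.P.s := fun h => mul_le_mul_of_nonneg_right h hs0.le
    have hMs : (Λ.M : ℝ) * Λ.P.s = 1 := by rw [mul_comm]; exact hsM
    rcases Nat.lt_or_gt_of_ne hi' with hlt | hgt
    · -- `i < i'`: the difference `(i - i') s ∈ [-(1-s), -s]`, shift `k₀ = -1`
      refine le_abs_sub_int (-1) ?_ ?_ k <;> push_cast
      · have h : ((ς'.1.1 : ℝ) + 1) ≤ Λ.M := by exact_mod_cast ς'.1.2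
        have := prod h
        have : ((ς'.1.1 : ℝ) + 1) * Λ.P.s = ς'.1.1 * Λ.P.s + Λ.P.s := by ring
        have h0 : (0 : ℝ) ≤ ς.1.1 * Λ.P.s := by positivity
        linarith
      · have h : ((ς.1.1 : ℝ) + 1) ≤ ς'.1.1 := by exact_mod_cast hlt
        have := prod h
        have : ((ς.1.1 : ℝ) + 1) * Λ.P.s = ς.1.1 * Λ.P.s + Λ.P.s := by ring
        linarith
    · refine le_abs_sub_int 0 ?_ ?_ k <;> push_cast
      · have h : ((ς'.1.1 : ℝ) + 1) ≤ ς.1.1 := by exact_mod_cast hgt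
        have := prod h
        have : ((ς'.1.1 : ℝ) + 1) * Λ.P.s = ς'.1.1 * Λ.P.s + Λ.P.s := by ring
        linarith
      · have h : ((ς.1.1 : ℝ) + 1) ≤ Λ.M := by exact_mod_cast ς.1.2
        have := prod h
        have : ((ς.1.1 : ℝ) + 1) * Λ.P.s = ς.1.1 * Λ.P.s + Λ.P.s := by ring
        have h0 : (0 : ℝ) ≤ ς'.1.1 * Λ.P.s := by positivity
        linarith
  · refine (min_le_right _ _).trans ?_
    by_cases h1 : ς.2.1 = ς'.2.1
    · have h2 : ς.2.2 ≠ ς'.2.2 := fun h2 => hline (Prod.ext h1 h2)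
      obtain ⟨k₀, hk1, hk2⟩ := trans_coord_sep (fw := 0) hn ς'.2.2.2 ς.2.2.2 (fun h => h2 (Fin.ext h).symm)
        (y := (ς'.2.2 : ℝ) / Λ.n) (y' := (ς.2.2 : ℝ) / Λ.n) (by simp) (by simp)
      refine le_norm_sepVec_of_coord (i := 2) fun k => ?_
      rw [slotVec_two, slotVec_two]
      have := le_abs_sub_int k₀ hk1 hk2 k
      simpa using this
    · obtain ⟨k₀, hk1, hk2⟩ := trans_coord_sep (fw := 0) hn ς'.2.1.2 ς.2.1.2 (fun h => h1 (Fin.ext h).symm)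
        (y := (ς'.2.1 : ℝ) / Λ.n) (y' := (ς.2.1 : ℝ) / Λ.n) (by simp) (by simp)
      refine le_norm_sepVec_of_coord (i := 1) fun k => ?_
      rw [slotVec_one, slotVec_one]
      have := le_abs_sub_int k₀ hk1 hk2 k
      simpa using this

/-- **Distinct labellings give disjoint events** (slots are farther apart than `2r`). [folklore] -/
theorem Ev_disjoint (hW : Λ.WinOK) {a' : Fin (N + 1) ≃ Λ.Slot} (hne : a ≠ a') :
    Disjoint (Λ.Ev a : Set (Cfg N)) (Λ.Ev a') := by
  classical
  have hΛ := hW.ok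
  have hP := hΛ.sep.adm
  rw [Set.disjoint_left]
  intro z hz hz'
  obtain ⟨p, hp⟩ : ∃ p, a p ≠ a' p := by
    by_contra h; push Not at h; exact hne (Equiv.ext h)
  have h1 : ‖Λ.offset a z p‖ ≤ Λ.P.r := (hz p).1
  have h2 : ‖Λ.offset a' z p‖ ≤ Λ.P.r := (hz' p).1
  have he := e1_le_errA (Λ := Λ) hP
  have hr : Λ.P.r ≤ Λ.P.errA := by
    have := hP.T_nn; have := hP.u_nn; nlinarith [he.1]
  have hr2 : 2 * Λ.P.r < min Λ.P.s (1 / Λ.n) := by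
    have := hW.long_sep; have := hW.trans_sep; have := hP.ε_pos
    exact lt_min (by linarith) (by linarith [he.2])
  -- the two slots project to points at torus distance `≤ 2r`
  have hproj : Torus.proj (Λ.slotVec (a p)) - Torus.proj (Λ.slotVec (a' p)) =
      Torus.proj (Λ.offset a' z p - Λ.offset a z p) := by
    have hx := Λ.pos_eq_proj a z p
    have hx' := Λ.pos_eq_proj a' z p
    have : Torus.proj (Λ.slotVec (a p) + Λ.offset a z p) = Torus.proj (Λ.slotVec (a' p) + Λ.offset a' z p) := by
      rw [← hx, ← hx']
    rw [Torus.proj_add, Torus.proj_add] at this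
    rw [proj_sub]
    exact sub_eq_sub_iff_add_eq_add.2 (by rw [this, add_comm])
  have hdist : ‖(Torus.geometry (Fin 3)).sepVec (Torus.proj (Λ.slotVec (a p))) (Torus.proj (Λ.slotVec (a' p)))‖ ≤ 2 * Λ.P.r := by
    rw [Torus.geometry_sepVec, hproj]
    calc ‖Torus.reprSym (Torus.proj (Λ.offset a' z p - Λ.offset a z p))‖
        ≤ ‖Λ.offset a' z p - Λ.offset a z p‖ := Torus.norm_reprSym_proj_le _
      _ ≤ ‖Λ.offset a' z p‖ + ‖Λ.offset a z p‖ := norm_sub_le _ _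
      _ ≤ 2 * Λ.P.r := by linarith
  have hsep := slot_sep hΛ hp
  linarith

/-- `gaussBallB` is nonnegative. [folklore] -/
theorem gaussBallB_nonneg (c : E3) {u : ℝ} (hu : 0 ≤ u) : 0 ≤ gaussBallB c u := by
  unfold gaussBallB; positivity

/-- **Gaussian mass of a ball from below.** [folklore] -/
theorem gaussMeasure_closedBall_ge (c : E3) {u : ℝ} (hu : 0 ≤ u) :
    ENNReal.ofReal (gaussBallB c u) ≤ gaussMeasure (0 : E3) 1 (Metric.closedBall c u) := by
  rw [← withDensity_localMaxwellian_eq_gaussMeasure one_pos (0 : E3), withDensity_apply _ measurableSet_closedBall]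
  set m : ℝ := (2 * Real.pi) ^ (-(3 : ℝ) / 2) * Real.exp (-(‖c‖ + u) ^ 2 / 2) with hm
  have hm0 : 0 ≤ m := by rw [hm]; positivity
  have hlow : ∀ v ∈ Metric.closedBall c u, ENNReal.ofReal m ≤ ENNReal.ofReal (localMaxwellian 1 1 (0 : E3) v) := by
    intro v hv
    refine ENNReal.ofReal_le_ofReal ?_
    rw [localMaxwellian, finrank_euclideanSpace_fin]
    simp only [Nat.cast_ofNat, one_mul, mul_one, sub_zero]
    rw [hm, show (-(3 : ℝ) / 2) = (-3 / 2 : ℝ) by norm_num]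
    refine mul_le_mul_of_nonneg_left ?_ (by positivity)
    refine Real.exp_le_exp.2 ?_
    have hvn : ‖v‖ ≤ ‖c‖ + u := by
      have := Metric.mem_closedBall.1 hv
      rw [dist_eq_norm] at this
      calc ‖v‖ = ‖(v - c) + c‖ := by rw [sub_add_cancel]
        _ ≤ ‖v - c‖ + ‖c‖ := norm_add_le _ _
        _ ≤ ‖c‖ + u := by linarith
    have h2 : ‖v‖ ^ 2 ≤ (‖c‖ + u) ^ 2 := pow_le_pow_left₀ (norm_nonneg _) hvn 2
    have : -(‖c‖ + u) ^ 2 / 2 ≤ -‖v‖ ^ 2 / 2 := by linarith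
    simpa using this
  calc ENNReal.ofReal (gaussBallB c u)
      = ENNReal.ofReal m * volume (Metric.closedBall c u) := by
        rw [gaussBallB, ← hm, EuclideanSpace.volume_closedBall_fin_three, ← ENNReal.ofReal_pow hu,
          ← ENNReal.ofReal_mul (by positivity), ← ENNReal.ofReal_mul hm0]
        congr 1; ring
    _ = ∫⁻ _ in Metric.closedBall c u, ENNReal.ofReal m := by rw [setLIntegral_const]
    _ ≤ ∫⁻ v in Metric.closedBall c u, ENNReal.ofReal (localMaxwellian 1 1 (0 : E3) v) :=
        setLIntegral_mono' measurableSet_closedBall hlow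

/-- The position part of the labelled event. [folklore] -/
def Xev (Λ : Lat) {N : ℕ} (a : Fin (N + 1) ≃ Λ.Slot) : Set (Fin (N + 1) → UnitAddTorus (Fin 3)) :=
  Set.pi Set.univ fun p => {x | Torus.euclidDist x (Torus.proj (Λ.slotVec (a p))) ≤ Λ.P.r}

/-- The velocity part of the labelled event. [folklore] -/
def Vev (Λ : Lat) {N : ℕ} (a : Fin (N + 1) ≃ Λ.Slot) : Set (Fin (N + 1) → E3) :=
  Set.pi Set.univ fun p => Metric.closedBall (Λ.drv (a p)) Λ.P.u

/-- Product structure of the labelled event. [folklore] -/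
theorem zipConfig_mem_Ev {x : Fin (N + 1) → UnitAddTorus (Fin 3)} {v : Fin (N + 1) → E3}
    (hx : x ∈ Λ.Xev a) (hv : v ∈ Λ.Vev a) : zipConfig (x, v) ∈ Λ.Ev a := by
  intro p
  constructor
  · have := hx p (Set.mem_univ p)
    simp only [Set.mem_setOf_eq] at this
    rw [offset, zipConfig_apply]
    exact this
  · have := hv p (Set.mem_univ p)
    rw [Metric.mem_closedBall, dist_eq_norm] at this
    rw [zipConfig_apply]; exact this

/-- `measurableSet_Xev` (technical, see the section header). [folklore] -/
theorem measurableSet_Xev : MeasurableSet (Λ.Xev a : Set (Fin (N + 1) → UnitAddTorus (Fin 3))) := by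
  refine MeasurableSet.univ_pi fun p => ?_
  exact measurableSet_le ((Torus.measurable_reprSym.comp (measurable_id.sub measurable_const)).norm) measurable_const

/-- `measurableSet_Vev` (technical, see the section header). [folklore] -/
theorem measurableSet_Vev : MeasurableSet (Λ.Vev a : Set (Fin (N + 1) → E3)) :=
  MeasurableSet.univ_pi fun _ => measurableSet_closedBall

/-- **The Gibbs probability of a labelled event from below**, uniformly in the labelling. [folklore] -/
theorem measure_Ev_ge (hW : Λ.WinOK) {σ : ℝ} (hσ : σ ≤ 1 / 2) (hε : hsDiameter σ N = Λ.P.ε)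
    (hr : Λ.P.r < 1 / 2) :
    ENNReal.ofReal (Λ.evB N) ≤
      localGibbsMeasure σ (fun _ => 1) (fun _ => 0) (fun _ => (1 : ℝ)) N (Λ.Ev a) := by
  classical
  have hΛ := hW.ok
  have hP := hΛ.sep.adm
  have hmeas : MeasurableSet (Λ.Ev a : Set (Cfg N)) := measurableSet_Ev
  rw [← lintegral_indicator_one hmeas,
    lintegral_localGibbsMeasure (a₀ := fun _ => (1 : ℝ)) (θ₀ := fun _ => (1 : ℝ)) (u₀ := fun _ => (0 : E3))
      continuous_const continuous_const continuous_const (fun _ => zero_le_one) (fun _ => one_pos) σ N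
      (measurable_one.indicator hmeas)]
  -- the partition function is in `(0, 1]`
  set Z := canonicalPartition (Torus.geometry (Fin 3)) (hsDiameter σ N) (N + 1)
    (localGibbsProfile (fun _ => (1 : ℝ)) (fun _ => (0 : E3)) (fun _ => (1 : ℝ))) with hZ
  have hZeq : Z = posPartition (fun _ => (1 : ℝ)) (hsDiameter σ N) (N + 1) :=
    canonicalPartition_eq_posPartition continuous_const continuous_const continuous_const
      (fun _ => zero_le_one) (fun _ => one_pos) _ _
  have hZpos : 0 < Z := by rw [hZeq]; exact posPartition_pos continuous_const (fun _ => one_pos) hσ N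
  have hZle : Z ≤ 1 := by
    rw [hZeq, posPartition]
    have h1 : ∫ x, posWeight (fun _ => (1 : ℝ)) (hsDiameter σ N) (N + 1) x ≤
        ∫ _ : Fin (N + 1) → UnitAddTorus (Fin 3), (1 : ℝ) :=
      integral_mono (integrable_posWeight continuous_const (fun _ => zero_le_one) _ _) (integrable_const 1)
        (fun x => by
          have := posWeight_le_pow (a₀ := fun _ => (1 : ℝ)) (fun _ => zero_le_one) (fun _ => le_rfl)
            (hsDiameter σ N) x (n := N + 1)
          simpa using this)
    have h2 : ∫ _ : Fin (N + 1) → UnitAddTorus (Fin 3), (1 : ℝ) = 1 := by simp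
    linarith
  have hr0 : 0 ≤ Λ.P.r := hP.r_nn
  have hu0 : 0 ≤ Λ.P.u := hP.u_nn
  have hZinv : 1 ≤ Z⁻¹ := one_le_inv_iff₀.2 ⟨hZpos, hZle⟩
  -- the velocity factor
  set CV : ENNReal := ∏ p : Fin (N + 1), ENNReal.ofReal (gaussBallB (Λ.drv (a p)) Λ.P.u) with hCV
  have hvel : ∀ x : Fin (N + 1) → UnitAddTorus (Fin 3), x ∈ Λ.Xev a →
      CV ≤ ∫⁻ v, (Λ.Ev a).indicator 1 (zipConfig (x, v)) ∂velMeasure (fun _ => (0 : E3)) (fun _ => (1 : ℝ)) x := by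
    intro x hx
    have hind : ∀ v, (Λ.Vev a).indicator (1 : (Fin (N + 1) → E3) → ENNReal) v ≤
        (Λ.Ev a).indicator 1 (zipConfig (x, v)) := by
      intro v
      by_cases hv : v ∈ Λ.Vev a
      · rw [Set.indicator_of_mem hv, Set.indicator_of_mem (zipConfig_mem_Ev hx hv)]; exact le_rfl
      · rw [Set.indicator_of_notMem hv]; exact bot_le
    calc CV = ∏ p : Fin (N + 1), ENNReal.ofReal (gaussBallB (Λ.drv (a p)) Λ.P.u) := hCV
      _ ≤ ∏ p : Fin (N + 1), gaussMeasure (0 : E3) 1 (Metric.closedBall (Λ.drv (a p)) Λ.P.u) :=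
          Finset.prod_le_prod' fun p _ => gaussMeasure_closedBall_ge _ hP.u_nn
      _ = velMeasure (fun _ => (0 : E3)) (fun _ => (1 : ℝ)) x (Λ.Vev a) := by
          rw [velMeasure, Vev, Measure.pi_pi]
      _ = ∫⁻ v, (Λ.Vev a).indicator 1 v ∂velMeasure (fun _ => (0 : E3)) (fun _ => (1 : ℝ)) x := by
          rw [lintegral_indicator_one measurableSet_Vev]
      _ ≤ _ := lintegral_mono hind
  -- the position factor
  have hpos : ∀ x : Fin (N + 1) → UnitAddTorus (Fin 3), x ∈ Λ.Xev a →
      (1 : ENNReal) ≤ ENNReal.ofReal (Z⁻¹ * posWeight (fun _ => (1 : ℝ)) (hsDiameter σ N) (N + 1) x) := by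
    intro x hx
    have hdom : x ∈ posDomain (hsDiameter σ N) (N + 1) := by
      have hv : (fun p => Λ.drv (a p)) ∈ Λ.Vev a := fun p _ => Metric.mem_closedBall_self hP.u_nn
      have := Ev_subset_domain hW (zipConfig_mem_Ev hx hv)
      rw [hε]
      exact (zipConfig_mem_hardSphereDomain_iff _ _ _).1 this
    have hw1 : posWeight (fun _ => (1 : ℝ)) (hsDiameter σ N) (N + 1) x = 1 := by
      rw [posWeight, Set.indicator_of_mem hdom]; simp
    rw [hw1, mul_one, ← ENNReal.ofReal_one]
    exact ENNReal.ofReal_le_ofReal hZinv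
  -- assemble
  have hXmeas : MeasurableSet (Λ.Xev a : Set (Fin (N + 1) → UnitAddTorus (Fin 3))) := measurableSet_Xev
  have hvolX : volume (Λ.Xev a) = (ENNReal.ofReal Λ.P.r ^ 3 * ENNReal.ofReal (Real.pi * 4 / 3)) ^ (N + 1) := by
    rw [Xev, volume_pi, Measure.pi_pi]
    simp only [Torus.volume_euclidDist_le hr, EuclideanSpace.volume_closedBall_fin_three, Finset.prod_const,
      Finset.card_univ, Fintype.card_fin]
  calc ENNReal.ofReal (Λ.evB N) = volume (Λ.Xev a) * CV := by
        rw [evB, hvolX, hCV, ENNReal.ofReal_mul (by positivity), ENNReal.ofReal_pow (by positivity),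
          ENNReal.ofReal_prod_of_nonneg (fun ς _ => gaussBallB_nonneg _ hP.u_nn)]
        congr 1
        · congr 1
          rw [ENNReal.ofReal_mul (by positivity), ← ENNReal.ofReal_pow hP.r_nn, mul_comm]
        · exact (Fintype.prod_equiv a (fun p => ENNReal.ofReal (gaussBallB (Λ.drv (a p)) Λ.P.u))
            (fun ς => ENNReal.ofReal (gaussBallB (Λ.drv ς) Λ.P.u)) (fun _ => rfl)).symm
    _ = ∫⁻ x, (Λ.Xev a).indicator (fun _ => CV) x := by rw [lintegral_indicator_const hXmeas, mul_comm]
    _ ≤ _ := by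
        refine lintegral_mono fun x => ?_
        by_cases hx : x ∈ Λ.Xev a
        · rw [Set.indicator_of_mem hx]
          calc CV = 1 * CV := (one_mul _).symm
            _ ≤ _ := mul_le_mul' (hpos x hx) (hvel x hx)
        · rw [Set.indicator_of_notMem hx]; exact bot_le

end Gibbs

end Lat

end Lattice

end EquilibriumClampedCollisionalWindowLDNegative

end Summit.AtomisticToContinuum.HydrodynamicLimit.Theorems

end
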